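import Summits.CriticalPhenomena.CardyFormulaZ2.Theorems.CardyBoundaryCoulombGasHalfPlaneMarkDensityLawInterleave
import Literature.Probability.Percolation.PlanarDuality

/-!
# `HalfPlaneMarkDensityLaw` (crux stmt-CriticalPhenomena-5661), line `Sketch`:
# stub `stub_firstHit_of_hCluster` — Positivity Q4 (deterministic planarity)

Let `ω_H = ω ∩ {e | both endpoints of e lie in H}` be the configuration restricted to the edges of the
lattice half-plane `H = ℤ × ℕ`, let `S` be the `ω_H`-cluster of `(k,0)` (the "`H`-cluster"), let
`t ∈ [lo, hi]` be such that `(t,0) ∈ S` and no `(s,0)` with `t < s < k` lies in `S`, and suppose that NO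
open path of `H` off `S` joins `(t, hi] × {0}` to `[cl, k−1] × {0}` (`hi < cl ≤ k`).  Then
`firstHit H ([lo,hi]×{0}) cl k` holds:

* `(t,0)` is joined to `(k,0)` inside `H` (indeed inside `H ∩ S`, `mem_openConnIn_hCluster`): an
  `ω_H`-open walk from `(t,0)` to `(k,0)` stays in `S` (every vertex of it is joined to `(k,0)`) and in
  `H` (every `ω_H`-open edge has both endpoints in `H`, `mem_halfPlane_of_openWalk`).
* no `(a₀,0)`, `lo ≤ a₀ ≤ hi`, is joined inside `H` to some `(s,0)`, `cl ≤ s < k`: such an open lattice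
  walk `π` avoids `S`, because `S` is closed under `ω`-open edges of `H` (`mem_hCluster_of_walk`) and
  `(s,0) ∉ S` (`t < s < k`).  If `a₀ > t` the walk `π` is an open path of `H` off `S` from
  `(t, hi] × {0}` to `[cl, k−1] × {0}` — excluded; `a₀ = t` is impossible as `(t,0) ∈ S`; and if `a₀ < t`
  the feet interleave, `a₀ < t < s < k`, so `π` meets the walk from `(t,0)` to `(k,0)` inside `S`
  (planarity of `ℤ × ℕ`, tree lemma `TwoArmLower.stub_interleave`) — again a vertex of `π` in `S`.
-/

noncomputable section

namespace Summit.CriticalPhenomena.CardyFormulaZ2.Cruxes.HalfPlaneMarkDensityLaw.SketchLine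

open Literature.Probability.Percolation Literature.Probability.LatticeModels
open MeasureTheory Filter Set SimpleGraph
open scoped Topology
open Summit.CriticalPhenomena.CardyFormulaZ2.Theorems.HalfPlaneMarkDensityLaw.Negative

namespace Positivity

/-- First coordinate of the boundary vertex `(k,0)`. [folklore] -/
private lemma fh_bpt_apply_zero (k : ℤ) : bpt k 0 = k := rfl

/-- Second coordinate of the boundary vertex `(k,0)`. [folklore] -/
private lemma fh_bpt_apply_one (k : ℤ) : bpt k 1 = 0 := rfl

/-- The boundary vertex `(k,0)` lies in the lattice half-plane. [folklore] -/
private lemma fh_bpt_mem_halfPlane (k : ℤ) : bpt k ∈ halfPlane := by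
  simp [halfPlane, fh_bpt_apply_one]

/-- A site on the boundary row is some `(a,0)`. [folklore] -/
private lemma fh_exists_eq_bpt {v : Site 2} (h : v 1 = 0) : ∃ a : ℤ, v = bpt a :=
  ⟨v 0, (site_eq_bpt_iff v (v 0)).2 ⟨h, rfl⟩⟩

/-- Every edge open in the configuration restricted to the edges of `H` has both endpoints in `H`, so a
walk of its open graph issued from a vertex of `H` ends in `H`. [folklore] -/
private lemma mem_halfPlane_of_openWalk {ω : BondConfig (Site 2)} {x y : Site 2}
    (p : (openGraph (ω ∩ {e : Sym2 (Site 2) | ∀ v ∈ e, v ∈ halfPlane})).Walk x y)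
    (hx : x ∈ halfPlane) : y ∈ halfPlane := by
  induction p with
  | nil => exact hx
  | @cons a b _ h _ ih =>
    rw [openGraph_adj] at h
    exact ih (h.1.2 b (Sym2.mem_mk_right a b))

/-- Every vertex of the `H`-cluster `S` of `(k,0)` lies in `H`. [folklore] -/
private lemma mem_halfPlane_of_mem_hCluster {ω : BondConfig (Site 2)} {S : Finset (Site 2)} {k : ℤ}
    (hcl : openCluster (ω ∩ {e : Sym2 (Site 2) | ∀ v ∈ e, v ∈ halfPlane}) (bpt k) = ↑S)
    {z : Site 2} (hz : z ∈ S) : z ∈ halfPlane := by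
  have hz' : z ∈ openCluster (ω ∩ {e : Sym2 (Site 2) | ∀ v ∈ e, v ∈ halfPlane}) (bpt k) := by
    rw [hcl]; exact hz
  obtain ⟨q⟩ := hz'
  exact mem_halfPlane_of_openWalk q (fh_bpt_mem_halfPlane k)

/-- KEY CLOSURE FACT: the `H`-cluster `S` of `(k,0)` is closed under `ω`-open lattice edges with both
endpoints in `H`; hence a lattice walk in `H` with `ω`-open edges starting in `S` ends in `S`. [folklore] -/
private lemma mem_hCluster_of_walk {ω : BondConfig (Site 2)} {S : Finset (Site 2)} {k : ℤ}
    (hcl : openCluster (ω ∩ {e : Sym2 (Site 2) | ∀ v ∈ e, v ∈ halfPlane}) (bpt k) = ↑S)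
    {x y : Site 2} (p : (zdGraph 2).Walk x y) (hH : ∀ z ∈ p.support, z ∈ halfPlane)
    (hω : ∀ e ∈ p.edges, e ∈ ω) (hx : x ∈ S) : y ∈ S := by
  induction p with
  | nil => exact hx
  | @cons a b c h p ih =>
    refine ih (fun z hz => hH z (by simp [hz])) (fun e he => hω e (by simp [he])) ?_
    have ha : a ∈ openCluster (ω ∩ {e : Sym2 (Site 2) | ∀ v ∈ e, v ∈ halfPlane}) (bpt k) := by
      rw [hcl]; exact hx
    have hab : (openGraph (ω ∩ {e : Sym2 (Site 2) | ∀ v ∈ e, v ∈ halfPlane})).Adj a b := by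
      rw [openGraph_adj]
      refine ⟨⟨hω _ (by simp), fun v hv => ?_⟩, h.ne⟩
      rcases Sym2.mem_iff.1 hv with rfl | rfl
      · exact hH _ (by simp)
      · exact hH _ (by simp)
    have hb : b ∈ openCluster (ω ∩ {e : Sym2 (Site 2) | ∀ v ∈ e, v ∈ halfPlane}) (bpt k) :=
      SimpleGraph.Reachable.trans ha hab.reachable
    rw [hcl] at hb
    exact hb

/-- If `(t,0)` lies in the `H`-cluster `S` of `(k,0)`, then `(t,0)` is joined to `(k,0)` inside `H ∩ S`.
[folklore] -/
private lemma mem_openConnIn_hCluster {ω : BondConfig (Site 2)} {S : Finset (Site 2)} {k t : ℤ}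
    (hcl : openCluster (ω ∩ {e : Sym2 (Site 2) | ∀ v ∈ e, v ∈ halfPlane}) (bpt k) = ↑S)
    (htS : bpt t ∈ S) : ω ∈ openConnIn (halfPlane ∩ (↑S : Set (Site 2))) (bpt t) (bpt k) := by
  have ht : bpt t ∈ openCluster (ω ∩ {e : Sym2 (Site 2) | ∀ v ∈ e, v ∈ halfPlane}) (bpt k) := by
    rw [hcl]; exact htS
  obtain ⟨p⟩ := SimpleGraph.Reachable.symm ht
  -- every vertex of `p` is joined to `(k,0)`, hence lies in `S`
  have hpS : ∀ z ∈ p.support, z ∈ S := fun z hz => by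
    have hz : z ∈ openCluster (ω ∩ {e : Sym2 (Site 2) | ∀ v ∈ e, v ∈ halfPlane}) (bpt k) :=
      (p.dropUntil z hz).reachable.symm
    rw [hcl] at hz
    exact hz
  exact mem_openConnIn_of_walk p (fun z hz => ⟨mem_halfPlane_of_mem_hCluster hcl (hpS z hz), hpS z hz⟩)
    (fun e he => (edgeSet_openGraph_subset _ (p.edges_subset_edgeSet he)).1)

/-- STUB Q4 (deterministic): if the `H`-cluster of `(k,0)` is `S`, with nearest-left bottom point `t ∈ [lo,hi]`, and no open path of `H` off `S` joins `(t,hi]×{0}` to `[cl,k)×{0}`, then `firstHit halfPlane ([lo,hi]×{0}) cl k` holds. [folklore] -/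
theorem stub_firstHit_of_hCluster :
    ∀ (ω : BondConfig (Site 2)) (S : Finset (Site 2)) (k t lo hi cl : ℤ), ω ⊆ (zdGraph 2).edgeSet →
      lo ≤ t → t ≤ hi → hi < cl → cl ≤ k → bpt t ∈ S → (∀ s : ℤ, t < s → s < k → bpt s ∉ S) →
      ω ∈ {ω : BondConfig (Site 2) | openCluster (ω ∩ {e : Sym2 (Site 2) | ∀ v ∈ e, v ∈ halfPlane}) (bpt (k)) = ↑S} →
      ω ∉ (⋃ u ∈ rowIcc (t + 1) hi, ⋃ v ∈ rowIcc cl (k - 1),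
          (openConnIn (halfPlane ∩ (↑S : Set (Site 2))ᶜ) u v : Set (BondConfig (Site 2)))) →
      ω ∈ firstHit halfPlane (rowIcc lo hi) cl k := by
  intro ω S k t lo hi cl hω hlot hthi hhicl _ htS hnear hcl hno
  rw [Set.mem_setOf_eq] at hcl
  -- the walk from `(t,0)` to `(k,0)` inside `H ∩ S`
  obtain ⟨Q, hQS, hQω⟩ := exists_walk_of_mem_openConnIn hω (mem_openConnIn_hCluster hcl htS)
  refine ⟨⟨bpt t, ?_, bpt k, rfl, mem_openConnIn_of_walk Q (fun z hz => (hQS z hz).1) hQω⟩, ?_⟩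
  · simp only [rowIcc, Set.mem_setOf_eq, fh_bpt_apply_zero, fh_bpt_apply_one, true_and]
    omega
  -- no point of `[lo,hi]×{0}` is joined inside `H` to `[cl,k)×{0}`
  rintro ⟨u, hu, v, hv, huv⟩
  obtain ⟨a₀, rfl⟩ := fh_exists_eq_bpt hu.1
  obtain ⟨s, rfl⟩ := fh_exists_eq_bpt hv.1
  simp only [rowIcc, rowIco, Set.mem_setOf_eq, fh_bpt_apply_zero, fh_bpt_apply_one] at hu hv
  obtain ⟨π, hπH, hπω⟩ := exists_walk_of_mem_openConnIn hω huv
  have hsS : bpt s ∉ S := hnear s (by omega) (by omega)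
  -- `π` avoids `S` (closure of `S` under open edges of `H`, and `(s,0) ∉ S`)
  have hπS : ∀ z ∈ π.support, z ∉ S := fun z hz hzS =>
    hsS (mem_hCluster_of_walk hcl (π.dropUntil z hz)
      (fun w hw => hπH w (π.support_dropUntil_subset_support hz hw))
      (fun e he => hπω e (π.edges_dropUntil_subset_edges hz he)) hzS)
  rcases lt_trichotomy t a₀ with hlt | rfl | hgt
  · -- `a₀ > t`: `π` is an open path of `H` off `S` from `(t,hi]×{0}` to `[cl,k-1]×{0}`
    refine hno (Set.mem_iUnion₂.2 ⟨bpt a₀, ?_, Set.mem_iUnion₂.2 ⟨bpt s, ?_, ?_⟩⟩)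
    · simp only [rowIcc, Set.mem_setOf_eq, fh_bpt_apply_zero, fh_bpt_apply_one, true_and]
      omega
    · simp only [rowIcc, Set.mem_setOf_eq, fh_bpt_apply_zero, fh_bpt_apply_one, true_and]
      omega
    · exact mem_openConnIn_of_walk π (fun z hz => ⟨hπH z hz, fun hzS => hπS z hz hzS⟩) hπω
  · -- `a₀ = t`: `(t,0) ∈ S` lies on `π`
    exact hπS _ π.start_mem_support htS
  · -- `a₀ < t`: interleaved feet `a₀ < t < s < k`, so `π` meets the walk `Q ⊆ S`
    obtain ⟨z, hzπ, hzQ⟩ := TwoArmLower.stub_interleave a₀ t s k hgt (by omega) (by omega) π Q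
      (fun z hz => hπH z hz) (fun z hz => mem_halfPlane_of_mem_hCluster hcl (hQS z hz).2)
    exact hπS z hzπ (hQS z hzQ).2

end Positivity

end Summit.CriticalPhenomena.CardyFormulaZ2.Cruxes.HalfPlaneMarkDensityLaw.SketchLine
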